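import Summits.ResolutionOfSingularities.ResolutionOfSingularities.Theorems.WildConesCampaignW46SurfacesMuDrop

/-!
# [OURS · L1 W4.6, rungs (i)/(ii)] The one-step Milnor drop in ALL classical regimes
# (`n ≤ 2` every `p`; `p = 2` every `n`) over EVERY field of characteristic `p`, and the crux
# `ClassicalRegimes` WITHOUT `[PerfectField κ]`

Cell res-hironaka (LADDER-RESOLUTION rung L, D-0089), slot W4.6, seat res-L1-s46-pv-2. Host: route `WildCones`,
crux `ClassicalRegimes` (stmt-ResolutionOfSingularities-16884), `--supports … --as helper`. Everything here is OURS: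
theorems about route `WildCones`' typed point-blow-up dynamics (`Theorems/WildConesClassicalRegimesDefs.lean`);
NOTHING is a statement of H. Hironaka's manuscript [Hironaka2017]; no FACT-LIST premise. AI review is weaker than
expert review.

Assembly of the campaign's Eq. (127)-role predicate `CampaignW46HypersurfacesMuDrop p n` (res-L1-type-o1, p468935:
`∀ κ [Field κ] [CharP κ p], WildCones.MuDrop p n κ` — the Milnor number drops at EVERY forced step, no
look-ahead) in all the regimes of the crux `ClassicalRegimes` (`(n ≤ 2) ∨ (p = 2)`):

* `campaignW46HypersurfacesMuDrop_curve (hp : p.Prime) : CampaignW46HypersurfacesMuDrop p 1` — plane curves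
  `z^p + a(u)`, every `p`, every field: the crux's `stub_muDropCurve` (perfect fields) + base change to an
  algebraic closure (route `JacobianBudget`'s kit via `CampaignW46.Surfaces.BaseChange`);
* surfaces `n = 2`: `campaignW46HypersurfacesMuDrop_surface` (this seat, `…CampaignW46SurfacesMuDrop`) and
  `p = 2`, every `n`: `campaignW46HypersurfacesMuDrop_two` (res-L1-s46-pv-4) — re-assembled as
  `campaignW46HypersurfacesMuDrop_classical : p.Prime → 0 < n → (n ≤ 2 ∨ p = 2) → CampaignW46HypersurfacesMuDrop p n`;
* `classicalRegimes_allFields` — the crux `ClassicalRegimes` WITHOUT ITS `[PerfectField κ]` BINDER: in the classical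
  regimes there is no infinite forced run over ANY field of characteristic `p` (one-step drop + a strictly decreasing
  `ℕ`-sequence is absurd); `classicalRegimes_exit_le_mu` — with the effective bound `μ(c₀)`.
-/

noncomputable section

-- single-problem summit: the doubled namespace component `ResolutionOfSingularities` is forced
set_option linter.dupNamespace false

open scoped BigOperators Classical

namespace Summit.ResolutionOfSingularities.ResolutionOfSingularities.Theorems

open WildCones CampaignW46.Surfaces.BaseChange

/-- [OURS · L1 W4.6; NOT a statement of the manuscript] **`CampaignW46HypersurfacesMuDrop p 1` for every prime
`p`**: the one-step Milnor drop for plane curves `z^p + a(u)` over EVERY field of characteristic `p` (the crux's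
`stub_muDropCurve` over an algebraic closure, transported back: `μ`, `Isol`, `MultP` are invariant and `step`
is equivariant under extension of the ground field). [folklore] -/
theorem campaignW46HypersurfacesMuDrop_curve {p : ℕ} (hp : p.Prime) : CampaignW46HypersurfacesMuDrop p 1 := by
  intro κ _ _ c i τ hI hM hI' hM'
  let L := AlgebraicClosure κ
  haveI : CharP L p := charP_of_injective_algebraMap (algebraMap κ L).injective p
  have hF := (forced_iff (L := L) c).mp ⟨hI, hM⟩
  have hF' := (forced_iff (L := L) (step p 1 κ i τ c)).mp ⟨hI', hM'⟩
  rw [step_eq] at hF'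
  have key := stub_muDropCurve p hp L _ i _ hF.1 hF.2 hF'.1 hF'.2
  rw [mu_eq (L := L) c, mu_eq (L := L) (step p 1 κ i τ c), step_eq]
  exact key

/-- [OURS · L1 W4.6 rungs (i)/(ii); NOT a statement of the manuscript] **The one-step Milnor drop in all
classical regimes**: for a prime `p` and `0 < n` with `n ≤ 2 ∨ p = 2`, `CampaignW46HypersurfacesMuDrop p n` —
the Milnor number drops at every forced step of the point-blow-up dynamics of `z^p = a(u₁,…,uₙ)` over every
field of characteristic `p` (curves: `…_curve`; surfaces: `…_surface`, this seat; `p = 2`: `…_two`,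
res-L1-s46-pv-4). [folklore] -/
theorem campaignW46HypersurfacesMuDrop_classical {p n : ℕ} (hp : p.Prime) (hn : 0 < n) (hreg : n ≤ 2 ∨ p = 2) :
    CampaignW46HypersurfacesMuDrop p n := by
  rcases hreg with hle | rfl
  · interval_cases n
    · exact campaignW46HypersurfacesMuDrop_curve hp
    · exact campaignW46HypersurfacesMuDrop_surface hp
  · exact campaignW46HypersurfacesMuDrop_two n

/-- [OURS · L1 W4.6 rungs (i)/(ii), replaces the ROLE of Th. 16.13 p.87 l.26–30 in the classical regimes; NOT a
statement of the manuscript] **The crux `ClassicalRegimes` WITHOUT `[PerfectField κ]`**: for a prime `p`, `0 < n`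
and `n ≤ 2 ∨ p = 2`, over EVERY field `κ` of characteristic `p`, no start state, chart word and translation word
make every state of the point-blow-up dynamics of `z^p = a(u₁,…,uₙ)` isolated of multiplicity `p` (the crux
`Theses.WildCones.ClassicalRegimes` states this over perfect fields; the Milnor descent does not need
perfectness). [folklore] -/
theorem classicalRegimes_allFields {p n : ℕ} (hp : p.Prime) (hn : 0 < n) (hreg : n ≤ 2 ∨ p = 2)
    (κ : Type) [Field κ] [CharP κ p] (c₀ : (Fin n → ℕ) → κ) (i : ℕ → Fin n) (t : ℕ → Fin n → κ) :
    ¬ InfRun p n κ c₀ i t := fun hall =>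
  no_strictAnti_nat (fun m => mu p n κ (run p n κ c₀ i t m)) fun m =>
    campaignW46HypersurfacesMuDrop_classical hp hn hreg κ _ (i m) (t m)
      (hall m).1 (hall m).2 (hall (m + 1)).1 (hall (m + 1)).2

/-- [OURS · L1 W4.6 rungs (i)/(ii); NOT a statement of the manuscript] **Effective exit in all classical regimes,
every field**: along every chart/translation word some state of index `≤ μ(c₀)` is not forced. [folklore] -/
theorem classicalRegimes_exit_le_mu {p n : ℕ} (hp : p.Prime) (hn : 0 < n) (hreg : n ≤ 2 ∨ p = 2)
    (κ : Type) [Field κ] [CharP κ p] (c₀ : (Fin n → ℕ) → κ) (i : ℕ → Fin n) (t : ℕ → Fin n → κ) :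
    ∃ m ≤ mu p n κ c₀, ¬ (Isol p n κ (run p n κ c₀ i t m) ∧ MultP p n κ (run p n κ c₀ i t m)) := by
  have hdrop := campaignW46HypersurfacesMuDrop_classical hp hn hreg κ
  by_contra h
  have hforced : ∀ m ≤ mu p n κ c₀, Isol p n κ (run p n κ c₀ i t m) ∧ MultP p n κ (run p n κ c₀ i t m) := by
    intro m hm
    by_contra h'
    exact h ⟨m, hm, h'⟩
  have hstep : ∀ m ≤ mu p n κ c₀, mu p n κ (run p n κ c₀ i t m) + m ≤ mu p n κ c₀ := by
    intro m
    induction m with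
    | zero => intro _; simp [run]
    | succ m ih =>
      intro hm
      have h1 : mu p n κ (run p n κ c₀ i t (m + 1)) < mu p n κ (run p n κ c₀ i t m) :=
        hdrop _ (i m) (t m) (hforced m (by omega)).1 (hforced m (by omega)).2
          (hforced (m + 1) hm).1 (hforced (m + 1) hm).2
      have := ih (by omega)
      omega
  have hM := hstep (mu p n κ c₀) le_rfl
  have hpos := CampaignW46.ThreefoldsCharTwo.mu_pos hp.two_le (hforced (mu p n κ c₀) le_rfl).1
    (hforced (mu p n κ c₀) le_rfl).2
  omega

end Summit.ResolutionOfSingularities.ResolutionOfSingularities.Theorems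

end
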